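import Mathlib.LinearAlgebra.Determinant
import Mathlib.LinearAlgebra.Dual.Lemmas
import Mathlib.LinearAlgebra.Alternating.Basic
import Mathlib.LinearAlgebra.Dimension.OrzechProperty
import Mathlib.LinearAlgebra.Finsupp.LinearCombination
import Mathlib.LinearAlgebra.FiniteDimensional.Lemmas
import HarnessLib

/-!
# Volume forms on subspaces, their contractions along global functionals, and the cross product
# (pure linear algebra over a field; cell `b2b-bsdres`, team n1011, ROUTE-1 item R1-56
# "S24(1) @ m = 1 in the kernel", row T-R1-56-S, FILE C = K4a, part 1 of 3)

HONEST FRAMING (cell `b2b-bsdres`, verbatim): research route; prove what is provable now; no claim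
beyond stated classes; nothing booked; no mark / label moved.  This file is PURE LINEAR ALGEBRA
over a field `k` — no Galois cohomology, no arithmetic.  Theorems and (non-`Prop`) constructions
only: no named fact, no conjecture node.

## What and why

The existence half of the Mazur–Rubin structure theorem for Kolyvagin systems of core rank one
over a residue field (`KS₁(T̄, 𝓕, 𝒫)` is a line and `κ ↦ κ_n` is onto `H¹_{𝓕(n)}(K, T̄)` at every
core vertex `n`) is, in Mazur–Rubin's second treatment (J. Théor. Nombres Bordeaux 28 (2016) §§6–8,
"Stark systems"), a statement about compatible families of TOP EXTERIOR POWERS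
`⋀^{1+ν(n)} H¹_{𝓕^n}(K, T̄)` under the contractions by the localisation functionals at the primes
of `n` (op. cit. Def. 6.1, Prop. A.1–A.2), followed by the "regulator" `Π_n` into `H¹_{𝓕(n)}`
(Def. 8.1, Prop. 8.3).  At rank `r = 1` over a field all of this is elementary multilinear
algebra, which this file supplies in a basis-free form WITHOUT exterior powers: a **volume form on
a finite-dimensional subspace `W` of an ambient space `V`, indexed by `σ`**, is an alternating
`σ`-form on the GLOBAL dual `Module.Dual k V` that only sees restrictions to `W`
(`VolumeForm.volOn σ W`: it vanishes as soon as one argument annihilates `W`); such forms are a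
LINE when `#σ = dim W` (`apply_eq_smul_volOf`, `volOf_ne_zero`); fixing some arguments to given
global functionals `t_s` (`restrictSlots`, `contract`) carries volume forms on `W′` to volume forms
on `W = W′ ⊓ ⋂ ker t_s` (`restrictSlots_mem_volOn`), INJECTIVELY when the dimensions match
(`restrictSlots_ne_zero`), and FUNCTORIALLY (`contract_contract`); and the **cross product**
`cross W ω φ ∈ W` of a volume form `ω` on `W` (index `Option ι`) with a family `φ : ι → Dual k V`
— the vector with `g (cross W ω φ) = ω (g, φ)` for every `g` (`apply_cross`) — lies in
`⋂ ker φ_i` (`apply_self_cross`), is non-zero exactly in the expected case (`cross_ne_zero`), and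
satisfies the SWAP identity `φ_i (cross ω (φ[i ↦ ψ])) = −ψ (cross ω φ)` (`apply_cross_update`),
which downstream is the finite–singular relation of a Kolyvagin system (the sign is Mazur–Rubin's
`(−1)^{ν(n)}`, Prop. 8.3).  Consumer: `KolyvaginStalkExistence.lean` (FILE D of the row), with
`k = 𝔽_p`, `V = H¹(K, T̄)`, `W = H¹_{𝓕^N}(K, T̄)`, `σ = Option N`.

References: B. Mazur, K. Rubin, *Controlling Selmer groups in the higher core rank case*, J. Théor.
Nombres Bordeaux 28 (2016) 145–183 (= arXiv:1312.4052), Def. 6.1, Lemma 6.4, Thm. 6.5, Def. 8.1,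
Prop. 8.3, Appendix A (read 2026-08-21, held).
-/

noncomputable section

open Function Module

namespace Summit.BirchSwinnertonDyer.Rank1Residual.GaloisImage.VolumeForm

universe u v w

/-! ## §1. Filling a family of arguments along an injection, and restricting slots of an alternating map -/

section RestrictSlots

variable {R : Type*} [CommRing R] {M : Type*} [AddCommGroup M] [Module R M]
  {N : Type*} [AddCommGroup N] [Module R N] {ι σ : Type*}

omit [AddCommGroup M] in
/-- Updating the family `x` at `i` and then filling along the injection `e` is updating the filled
family at `e i` (`Function.extend e x t` takes the value `x i` at `e i` and `t s` off the range of
`e`). [folklore] -/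
theorem extend_update [DecidableEq ι] [DecidableEq σ] {e : ι → σ} (he : Injective e)
    (x : ι → M) (t : σ → M) (i : ι) (a : M) :
    Function.extend e (update x i a) t = update (Function.extend e x t) (e i) a := by
  funext s
  by_cases hs : ∃ j, e j = s
  · obtain ⟨j, rfl⟩ := hs
    rw [he.extend_apply]
    by_cases hji : j = i
    · subst hji; simp
    · rw [update_of_ne hji, update_of_ne (he.ne hji), he.extend_apply]
  · rw [extend_apply' _ _ _ hs, update_of_ne, extend_apply' _ _ _ hs]
    rintro rfl
    exact hs ⟨i, rfl⟩

/-- **Restricting the slots of an alternating map**: for an alternating `σ`-form `ω`, an injection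
`e : ι ↪ σ` and fixed arguments `t` (used off the range of `e`), the alternating `ι`-form
`x ↦ ω (Function.extend e x t)` — the arguments indexed by `ι` are free, the others frozen at `t`.
(Mazur–Rubin's contraction `⋀^{r+t} → ⋀^{r+s}` by fixed functionals, App. A / Def. 6.1, in the
dual picture.) [folklore] -/
def restrictSlots (ω : M [⋀^σ]→ₗ[R] N) {e : ι → σ} (he : Injective e) (t : σ → M) :
    M [⋀^ι]→ₗ[R] N where
  toFun x := ω (Function.extend e x t)
  map_update_add' x i a b := by
    classical
    rw [extend_update he, extend_update he, extend_update he]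
    convert ω.map_update_add (Function.extend e x t) (e i) a b
  map_update_smul' x i c a := by
    classical
    rw [extend_update he, extend_update he]
    convert ω.map_update_smul (Function.extend e x t) (e i) c a
  map_eq_zero_of_eq' x i j hx hij :=
    ω.map_eq_zero_of_eq _ (by rw [he.extend_apply, he.extend_apply, hx]) (he.ne hij)

/-- Unfolding `restrictSlots`. [folklore] -/
@[simp] theorem restrictSlots_apply (ω : M [⋀^σ]→ₗ[R] N) {e : ι → σ} (he : Injective e)
    (t : σ → M) (x : ι → M) : restrictSlots ω he t x = ω (Function.extend e x t) := rfl

/-- `restrictSlots` is additive in the form. [folklore] -/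
theorem restrictSlots_add (ω ω' : M [⋀^σ]→ₗ[R] N) {e : ι → σ} (he : Injective e) (t : σ → M) :
    restrictSlots (ω + ω') he t = restrictSlots ω he t + restrictSlots ω' he t := by
  ext x; rfl

/-- `restrictSlots` is homogeneous in the form. [folklore] -/
theorem restrictSlots_smul (c : R) (ω : M [⋀^σ]→ₗ[R] N) {e : ι → σ} (he : Injective e) (t : σ → M) :
    restrictSlots (c • ω) he t = c • restrictSlots ω he t := by
  ext x; rfl

/-- `restrictSlots` of the zero form. [folklore] -/
@[simp] theorem restrictSlots_zero {e : ι → σ} (he : Injective e) (t : σ → M) :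
    restrictSlots (0 : M [⋀^σ]→ₗ[R] N) he t = 0 := by
  ext x; rfl

omit [AddCommGroup M] in
/-- Filling in two steps along `e' ∘ e` is filling in one step, when the frozen arguments of the
inner step are those of the outer step read through `e'`. [folklore] -/
theorem extend_extend {ι' : Type*} {e : ι → ι'} {e' : ι' → σ} (he : Injective e)
    (he' : Injective e') (y : ι → M) (t : σ → M) :
    Function.extend e' (Function.extend e y (t ∘ e')) t = Function.extend (e' ∘ e) y t := by
  funext s
  by_cases hs : ∃ b, e' b = s
  · obtain ⟨b, rfl⟩ := hs
    rw [he'.extend_apply]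
    by_cases hb : ∃ a, e a = b
    · obtain ⟨a, rfl⟩ := hb
      rw [he.extend_apply, show e' (e a) = (e' ∘ e) a from rfl, (he'.comp he).extend_apply]
    · rw [extend_apply' _ _ _ hb,
        Function.extend_apply' (f := e' ∘ e) y t (e' b) (fun ⟨a, ha⟩ => hb ⟨a, he' ha⟩)]
      rfl
  · rw [extend_apply' _ _ _ hs,
      Function.extend_apply' (f := e' ∘ e) y t s (fun ⟨a, ha⟩ => hs ⟨e a, ha⟩)]

/-- **Functoriality of slot restriction**: restricting along `e'` (frozen at `t`) and then along `e`
(frozen at `t ∘ e'`) is restricting along `e' ∘ e` (frozen at `t`) — Mazur–Rubin's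
`Ψ_{n′,n″} ∘ Ψ_{n,n′} = Ψ_{n,n″}` (JTNB 28 (2016) Prop. 6.2) in the dual picture, with NO sign
because the slots are indexed, not ordered. [folklore] -/
theorem restrictSlots_restrictSlots {ι' : Type*} (ω : M [⋀^σ]→ₗ[R] N) {e : ι → ι'} {e' : ι' → σ}
    (he : Injective e) (he' : Injective e') (t : σ → M) :
    restrictSlots (restrictSlots ω he' t) he (t ∘ e') = restrictSlots ω (he'.comp he) t := by
  ext y
  simp only [restrictSlots_apply]
  rw [extend_extend he he']

end RestrictSlots

/-! ## §2. Volume forms on a subspace: alternating forms on the global dual that only see `W` -/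

section VolOn

variable {k : Type*} [Field k] {V : Type*} [AddCommGroup V] [Module k V] {σ : Type*}

/-- **Volume forms on the subspace `W ≤ V`, indexed by `σ`**: the alternating `σ`-forms on the
GLOBAL dual `Module.Dual k V` which vanish as soon as one argument annihilates `W` — i.e. which only
see the restrictions of their arguments to `W` (`apply_eq_of_forall_dualRestrict_eq`).  When
`#σ = dim W` they form a line (`apply_eq_smul_volOf`) — the top exterior power `⋀^{dim W} W` of
Mazur–Rubin's Stark systems (JTNB 28 (2016) Def. 6.1), realised without exterior algebra.
[folklore] -/
def volOn (σ : Type*) (W : Submodule k V) : Submodule k ((Module.Dual k V) [⋀^σ]→ₗ[k] k) where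
  carrier := {ω | ∀ (x : σ → Module.Dual k V) (i : σ), (∀ w ∈ W, x i w = 0) → ω x = 0}
  zero_mem' := fun _ _ _ => rfl
  add_mem' := fun {a b} ha hb x i hi => by
    simp only [AlternatingMap.add_apply, ha x i hi, hb x i hi, add_zero]
  smul_mem' := fun c a ha x i hi => by
    simp only [AlternatingMap.smul_apply, ha x i hi, smul_zero]

/-- Membership in `volOn σ W`. [folklore] -/
theorem mem_volOn_iff {W : Submodule k V} {ω : (Module.Dual k V) [⋀^σ]→ₗ[k] k} :
    ω ∈ volOn σ W ↔
      ∀ (x : σ → Module.Dual k V) (i : σ), (∀ w ∈ W, x i w = 0) → ω x = 0 :=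
  Iff.rfl

/-- **A volume form on `W` only sees restrictions to `W`**: `ω x = ω (L ∘ x)` for the projector
`L = dualLift ∘ dualRestrict` onto lifted functionals (expand `ω (Lx + (x − Lx))` over subsets of
slots, `MultilinearMap.map_add_univ`; every term with a slot from `x − Lx`, which annihilates `W`,
vanishes). [folklore] -/
theorem apply_eq_apply_dualLift_dualRestrict [Fintype σ] {W : Submodule k V}
    {ω : (Module.Dual k V) [⋀^σ]→ₗ[k] k} (hω : ω ∈ volOn σ W) (x : σ → Module.Dual k V) :
    ω x = ω (fun i => Subspace.dualLift W (W.dualRestrict (x i))) := by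
  classical
  set y : σ → Module.Dual k V := fun i => Subspace.dualLift W (W.dualRestrict (x i)) with hy
  have hxy : x = y + (x - y) := by abel
  have hann : ∀ i, ∀ w ∈ W, (x - y) i w = 0 := by
    intro i w hw
    have h1 : y i w = x i w := by
      simp only [hy]
      rw [Subspace.dualLift_of_mem hw, Submodule.dualRestrict_apply]
    rw [Pi.sub_apply, LinearMap.sub_apply, h1, sub_self]
  conv_lhs => rw [hxy]
  rw [show ω (y + (x - y)) = ω.toMultilinearMap (y + (x - y)) from rfl,
    ω.toMultilinearMap.map_add_univ y (x - y)]
  rw [Finset.sum_eq_single Finset.univ]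
  · simp only [Finset.piecewise_univ]; rfl
  · intro s _ hs
    obtain ⟨i, hi⟩ : ∃ i, i ∉ s := by
      by_contra h
      exact hs (Finset.eq_univ_of_forall fun i => not_not.mp fun hi => h ⟨i, hi⟩)
    change ω (s.piecewise y (x - y)) = 0
    refine hω _ i fun w hw => ?_
    rw [Finset.piecewise_eq_of_notMem _ _ _ hi]
    exact hann i w hw
  · intro h; exact absurd (Finset.mem_univ _) h

/-- Two families of global functionals with the same restrictions to `W`, slot by slot, have the
same volume. [folklore] -/
theorem apply_eq_of_forall_dualRestrict_eq [Fintype σ] {W : Submodule k V}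
    {ω : (Module.Dual k V) [⋀^σ]→ₗ[k] k} (hω : ω ∈ volOn σ W) {x y : σ → Module.Dual k V}
    (h : ∀ i, W.dualRestrict (x i) = W.dualRestrict (y i)) : ω x = ω y := by
  rw [apply_eq_apply_dualLift_dualRestrict hω x, apply_eq_apply_dualLift_dualRestrict hω y]
  simp only [h]

/-- Slotwise version: arguments agreeing on `W` give the same volume. [folklore] -/
theorem apply_eq_of_forall_apply_eq [Fintype σ] {W : Submodule k V}
    {ω : (Module.Dual k V) [⋀^σ]→ₗ[k] k} (hω : ω ∈ volOn σ W) {x y : σ → Module.Dual k V}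
    (h : ∀ i, ∀ w ∈ W, x i w = y i w) : ω x = ω y :=
  apply_eq_of_forall_dualRestrict_eq hω fun i => by
    ext w; simpa [Submodule.dualRestrict_apply] using h i w w.2

/-- **The descent of a volume form to the subspace**: `ω̄ := ω ∘ dualLift`, an alternating form on
`Module.Dual k W` with `ω x = ω̄ (x|_W)` (`apply_eq_descend`). [folklore] -/
def descend (W : Submodule k V) (ω : (Module.Dual k V) [⋀^σ]→ₗ[k] k) :
    (Module.Dual k W) [⋀^σ]→ₗ[k] k :=
  ω.compLinearMap (Subspace.dualLift W)

/-- Unfolding `descend`. [folklore] -/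
@[simp] theorem descend_apply (W : Submodule k V) (ω : (Module.Dual k V) [⋀^σ]→ₗ[k] k)
    (y : σ → Module.Dual k W) : descend W ω y = ω (fun i => Subspace.dualLift W (y i)) := rfl

/-- `ω x = ω̄ (x|_W)` for a volume form `ω` on `W`. [folklore] -/
theorem apply_eq_descend [Fintype σ] {W : Submodule k V} {ω : (Module.Dual k V) [⋀^σ]→ₗ[k] k}
    (hω : ω ∈ volOn σ W) (x : σ → Module.Dual k V) :
    ω x = descend W ω (fun i => W.dualRestrict (x i)) := by
  rw [descend_apply, apply_eq_apply_dualLift_dualRestrict hω x]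

/-! ## §3. Volume forms are a line when `#σ = dim W` -/

variable [Fintype σ] [DecidableEq σ]

/-- **The volume form of a basis** `b : Basis σ k W`: `x ↦ det (x_i|_W)` in the dual basis of `b`,
i.e. `det (x_i (b_j))_{i,j}`. [folklore] -/
def volOf {W : Submodule k V} (b : Basis σ k W) : (Module.Dual k V) [⋀^σ]→ₗ[k] k :=
  b.dualBasis.det.compLinearMap W.dualRestrict

/-- Unfolding `volOf`. [folklore] -/
@[simp] theorem volOf_apply {W : Submodule k V} (b : Basis σ k W) (x : σ → Module.Dual k V) :
    volOf b x = b.dualBasis.det (fun i => W.dualRestrict (x i)) := rfl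

/-- `volOf b` is a volume form on `W`. [folklore] -/
theorem volOf_mem_volOn {W : Submodule k V} (b : Basis σ k W) : volOf b ∈ volOn σ W := by
  intro x i hi
  rw [volOf_apply]
  have h0 : W.dualRestrict (x i) = 0 := by
    ext w; simpa [Submodule.dualRestrict_apply] using hi w w.2
  exact b.dualBasis.det.map_coord_zero i h0

/-- `volOf b` takes the value `1` on any lift of the dual basis: it is not zero. [folklore] -/
theorem volOf_apply_dualLift_dualBasis {W : Submodule k V} (b : Basis σ k W) :
    volOf b (fun i => Subspace.dualLift W (b.dualBasis i)) = 1 := by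
  rw [volOf_apply]
  simp only [Subspace.dualRestrict_leftInverse W _]
  exact b.dualBasis.det_self

/-- `volOf b ≠ 0`. [folklore] -/
theorem volOf_ne_zero {W : Submodule k V} (b : Basis σ k W) : volOf b ≠ 0 := fun h => by
  have := volOf_apply_dualLift_dualBasis b
  rw [h, AlternatingMap.zero_apply] at this
  exact zero_ne_one this

/-- **Volume forms are a line**: every volume form on `W` indexed by `σ` is a multiple of
`volOf b` for any basis `b : Basis σ k W`, the multiplier being its value on the lifted dual basis
(`AlternatingMap.eq_smul_basis_det` for the descended form). [folklore] -/
theorem apply_eq_smul_volOf {W : Submodule k V} (b : Basis σ k W)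
    {ω : (Module.Dual k V) [⋀^σ]→ₗ[k] k} (hω : ω ∈ volOn σ W) :
    ω = ω (fun i => Subspace.dualLift W (b.dualBasis i)) • volOf b := by
  ext x
  rw [apply_eq_descend hω x, AlternatingMap.eq_smul_basis_det b.dualBasis (descend W ω)]
  rfl

/-- **A non-zero volume form is non-zero on every family restricting to a basis of `W^*`**:
if `ω ≠ 0` is a volume form on `W` and the restrictions `x_i|_W` are linearly independent (hence a
basis of `Module.Dual k W`, `#σ = dim W`), then `ω x ≠ 0`. [folklore] -/
theorem apply_ne_zero_of_linearIndependent {W : Submodule k V} [FiniteDimensional k W]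
    (hσ : Fintype.card σ = Module.finrank k W)
    {ω : (Module.Dual k V) [⋀^σ]→ₗ[k] k} (hω : ω ∈ volOn σ W) (hω0 : ω ≠ 0)
    {x : σ → Module.Dual k V} (hx : LinearIndependent k fun i => W.dualRestrict (x i)) :
    ω x ≠ 0 := by
  -- a basis of `W` indexed by `σ`
  have b : Basis σ k W :=
    (Module.finBasisOfFinrankEq k W hσ.symm).reindex (Fintype.equivFinOfCardEq rfl).symm
  have hc : ω (fun i => Subspace.dualLift W (b.dualBasis i)) ≠ 0 := by
    intro h0
    apply hω0
    rw [apply_eq_smul_volOf b hω, h0, zero_smul]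
  rw [apply_eq_smul_volOf b hω, AlternatingMap.smul_apply, volOf_apply, smul_eq_mul]
  refine mul_ne_zero hc ?_
  -- the restrictions form a basis of `W^*`: the determinant in the dual basis is a unit
  have hcard : Fintype.card σ = Module.finrank k (Module.Dual k W) := by
    rw [Subspace.dual_finrank_eq, hσ]
  have hspan : Submodule.span k (Set.range fun i => W.dualRestrict (x i)) = ⊤ :=
    hx.span_eq_top_of_card_eq_finrank' hcard
  exact ((Module.Basis.is_basis_iff_det b.dualBasis).mp ⟨hx, hspan⟩).ne_zero

end VolOn

end Summit.BirchSwinnertonDyer.Rank1Residual.GaloisImage.VolumeForm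

end
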